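import Mathlib
import HarnessLib

/-!
# The reflex of a CM type, at the level of the Galois group

Shimura, *Abelian Varieties with Complex Multiplication and Modular Functions* (1998), §8.1–8.3
(Propositions 25, 26, 28 and the paragraph following Proposition 28) [Shimura1998], and Streng,
*Complex multiplication of abelian surfaces* (thesis, Leiden 2010), Ch. I §3 (Def. 3.2, Lemma 3.5) and §7
(Def. 7.1, Lemmas 7.2, 7.3) [Streng2010], formalised in the abstract setting of a group `G` acting on a type `E`.

## Dictionary

Let `F` be a number field, `L` a Galois extension of `ℚ` containing `F` (Shimura, Prop. 25), `G = Gal(L/ℚ)`,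
and `Φ = {φ₁, …, φₙ}` a set of embeddings `F → L`.  We let `G` act on `E := Hom(F, L)` on the LEFT by
composition, `g • φ = g ∘ φ`, and write `φh : E` for the inclusion `F ⊆ L`, so that
`MulAction.stabilizer G φh = Gal(L/F)` is Shimura's `H₁`.  (Shimura writes the action exponentially,
`ξ^(σγ) = (ξ^σ)^γ`; a product `σγ` of [Shimura1998] is the composite `γ ∘ σ = γ * σ` here.  Streng composes maps
as we do.)  With this translation:

* `typeLift Φ φh = {g | g • φh ∈ Φ}` is Shimura's `S` = "the set of all the elements of `G` inducing some `φᵢ`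
  on `F`" (Prop. 25) = Streng's `Φ_L`, the CM type of `L` induced by `Φ` (Def. 3.2);
* `reflexLift Φ φh = {g | g⁻¹ • φh ∈ Φ} = (typeLift Φ φh)⁻¹` is Shimura's `S* = {σ⁻¹ | σ ∈ S}` (Prop. 28) =
  Streng's `Φ_L⁻¹` (§7): the reflex type, lifted ("induced") to `L`;
* `MulAction.stabilizer G Φ = {γ | γ • Φ = Φ}` is Shimura's `H* = {γ | γS* = S*}` (Prop. 28; in composition
  order the RIGHT stabiliser `{u | S* u = S*}` of `S*`, see `forall_mul_mem_reflexLift_iff`) = Streng's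
  `Gal(L/Kʳ) = {σ | σΦ = Φ}` (Lemma 7.3).  Its fixed field `K*` is the REFLEX FIELD (`reflexField`), and the reflex
  type `{ψⱼ}` is the set of restrictions of the elements of `S*` to `K*` (Prop. 28, Def. 7.1) — at group level it is
  carried by `S*` itself, which is right-`H*`-invariant (`mul_mem_reflexLift_iff_of_mem_stabilizer`);
* `MulAction.stabilizer G (reflexLift Φ φh)` (left translation on `Set G`) is Shimura's `H' = {γ | γS = S}`
  (Prop. 26; in composition order the right stabiliser of `S`, see `mem_stabilizer_reflexLift_iff`) = Streng's
  `{σ | Φ_L σ = Φ_L} = Gal(L/K₁)` ((3.6) in Lemma 3.5), `K₁ ⊆ F` the unique subfield from which `Φ` is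
  primitively induced.

## Contents (everything is kernel-proved)

* the calculus of `typeLift` / `reflexLift`; `H₁ ≤ H'` (`stabilizer_le_stabilizer_reflexLift`: "F contains the
  field K' corresponding to H'", first line of the proof of Prop. 26);
* `S* H* = S*`, and `H*` IS the right stabiliser of `S*` when the action is transitive
  (`forall_mul_mem_reflexLift_iff`); hence right-invariance of `S*` under a subgroup `H` forces `H ≤ H*`, and by
  the Galois correspondence the reflex field lies in the fixed field of `H` (`reflexField_le_of_forall_mul_mem_iff`);
* the reflex of the reflex (Streng Lemma 7.2; Shimura §8.3 after Prop. 28): the construction applied to the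
  lifted reflex type `S* ⊆ G = Hom(L, L)` with base point `1` returns `S` (`reflexLift_reflexLift_one`), its `H*`
  is `H' ⊇ H₁` ("`Kʳʳ` is a subfield of `K`"), and `{g • φh | g ∈ S · H'} = Φ` (`image_typeLift_mul_stabilizer_eq`:
  "`Φ` is induced by `Φʳʳ`");
* primitivity at group level (`IsPrimitive`: `S` is right-invariant under no subgroup strictly above `H₁`, the
  group-theoretic content of Streng's Def. 3.2 "not induced from a CM type of a strict CM subfield") and the
  criterion of Shimura Prop. 26 / Streng (3.6): `isPrimitive_iff : IsPrimitive G Φ φh ↔ H' ≤ H₁`.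

Transitivity (`MulAction.IsPretransitive G E`) is the one hypothesis on the action; for `E = Hom(F, L)` with
`L/ℚ` normal it is the extension of embeddings to automorphisms of `L`.

## Provenance

Staged by the pub-hodgecm formalisation cell (DAG-node prover #04 lineage) under the LEAN-IN-TREE rule; it
supersedes, re-sourced to print, the group-level parts of the cell's standalone package files
`HodgeCM/PerL34/ReflexWelldef.lean` and `HodgeCM/CM/TypeOfDet.lean` §(C).

## Not here

The CM condition (Prop. 25 (1): `G = S ∪ Sσρσ⁻¹`), abelian varieties (Shimura DEFINES "primitive" by the
simplicity of the abelian varieties of the type, §8.2, and Prop. 26 is his criterion; we only formalise the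
group-theoretic side), the generation statement `K* = ℚ(∑ᵢ ξ^φᵢ)` of Prop. 28, and the type norm (Prop. 29).
-/

set_option autoImplicit false

open scoped Pointwise

namespace Literature.NumberTheory.ComplexMultiplication

variable {G : Type*} [Group G] {E : Type*} [MulAction G E]

/-- Shimura's `S`: the elements of `G` inducing on `F` some element of the type `Φ` — with `G` acting on
`E = Hom(F, L)` by composition and `φh` the inclusion, `S = {g | g ∘ φh ∈ Φ}`; equivalently the type of `L`
induced by `Φ` (Streng, Def. 3.2, `Φ_L`). [cite: Shimura1998, §8.1 Prop. 25] -/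
def typeLift (Φ : Set E) (φh : E) : Set G := {g : G | g • φh ∈ Φ}

/-- Shimura's `S* = {σ⁻¹ | σ ∈ S}`: the reflex type of `(F, Φ)` lifted to `L`, i.e. the elements of `G` whose
restriction to the reflex field `K*` belongs to the reflex type (Streng §7: `Φ_L⁻¹`).
[cite: Shimura1998, §8.3 Prop. 28] -/
def reflexLift (Φ : Set E) (φh : E) : Set G := {g : G | g⁻¹ • φh ∈ Φ}

/-- [folklore] -/
theorem mem_typeLift (Φ : Set E) (φh : E) (g : G) : g ∈ typeLift Φ φh ↔ g • φh ∈ Φ := Iff.rfl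

/-- [folklore] -/
theorem mem_reflexLift (Φ : Set E) (φh : E) (g : G) : g ∈ reflexLift Φ φh ↔ g⁻¹ • φh ∈ Φ := Iff.rfl

/-- `S* = S⁻¹`. [cite: Shimura1998, §8.3 Prop. 28] -/
theorem reflexLift_eq_inv (Φ : Set E) (φh : E) : (reflexLift Φ φh : Set G) = (typeLift Φ φh)⁻¹ := by
  ext g
  rw [Set.mem_inv, mem_reflexLift, mem_typeLift]

/-- [folklore] -/
theorem inv_mem_reflexLift_iff (Φ : Set E) (φh : E) (g : G) : g⁻¹ ∈ reflexLift Φ φh ↔ g ∈ typeLift Φ φh := by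
  rw [mem_reflexLift, inv_inv, mem_typeLift]

/-- [folklore] -/
theorem inv_mem_typeLift_iff (Φ : Set E) (φh : E) (g : G) : g⁻¹ ∈ typeLift Φ φh ↔ g ∈ reflexLift Φ φh := by
  rw [mem_reflexLift, mem_typeLift]

/-- `S H₁ = S` (composition order; Shimura: "`HS = S`", proof of Prop. 29): `S` is right-invariant under
`H₁ = Stab(φh) = Gal(L/F)`. [cite: Shimura1998, §8.3 proof of Prop. 29] -/
theorem mul_mem_typeLift_iff_of_mem_stabilizer (Φ : Set E) (φh : E) {h : G}
    (hh : h ∈ MulAction.stabilizer G φh) (g : G) : g * h ∈ typeLift Φ φh ↔ g ∈ typeLift Φ φh := by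
  rw [MulAction.mem_stabilizer_iff] at hh
  rw [mem_typeLift, mem_typeLift, mul_smul, hh]

/-- `S* H* = S*` (composition order; Shimura: "`γ⁻¹S* = S*`" for `γ ∈ H*`, proof of Prop. 28): the lifted
reflex type is right-invariant under `H* = Stab(Φ)`, i.e. it is induced from the reflex field.
[cite: Shimura1998, §8.3 proof of Prop. 28] -/
theorem mul_mem_reflexLift_iff_of_mem_stabilizer (Φ : Set E) (φh : E) {u : G}
    (hu : u ∈ MulAction.stabilizer G Φ) (τ : G) : τ * u ∈ reflexLift Φ φh ↔ τ ∈ reflexLift Φ φh := by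
  rw [MulAction.mem_stabilizer_iff] at hu
  simp only [mem_reflexLift, mul_inv_rev, mul_smul]
  constructor
  · intro h
    have : u • (u⁻¹ • τ⁻¹ • φh) ∈ u • Φ := Set.smul_mem_smul_set h
    rwa [smul_inv_smul, hu] at this
  · intro h
    rw [← hu, Set.mem_smul_set_iff_inv_smul_mem] at h
    exact h

/-- **`H*` is the right stabiliser of `S*`** (for a transitive action): `(∀ τ, τ u ∈ S* ↔ τ ∈ S*) ↔ u • Φ = Φ`.
This is the identification of Shimura's `H* = {γ | γS* = S*}` (exponential notation) with Streng's
`{σ | σΦ = Φ}`. [cite: Streng2010, Ch. I Lemma 7.3] -/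
theorem forall_mul_mem_reflexLift_iff [MulAction.IsPretransitive G E] (Φ : Set E) (φh : E) (u : G) :
    (∀ τ : G, τ * u ∈ reflexLift Φ φh ↔ τ ∈ reflexLift Φ φh) ↔ u ∈ MulAction.stabilizer G Φ := by
  refine ⟨fun h => ?_, fun hu τ => mul_mem_reflexLift_iff_of_mem_stabilizer Φ φh hu τ⟩
  rw [MulAction.mem_stabilizer_iff]
  have key : ∀ x : E, u⁻¹ • x ∈ Φ ↔ x ∈ Φ := by
    intro x
    obtain ⟨g, hg⟩ := MulAction.exists_smul_eq G φh x
    have := h g⁻¹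
    simp only [mem_reflexLift, mul_inv_rev, inv_inv, mul_smul, hg] at this
    exact this
  ext x
  rw [Set.mem_smul_set_iff_inv_smul_mem]
  exact key x

/-- If `S*` is right-invariant under a subgroup `H` (i.e. the indicator of `S*` factors through `G/H`, "`S*` is
induced from `L^H`"), then `H ≤ H*`. [folklore] -/
theorem le_stabilizer_of_forall_mul_mem_reflexLift_iff [MulAction.IsPretransitive G E] (Φ : Set E) (φh : E)
    (H : Subgroup G) (hH : ∀ h ∈ H, ∀ τ : G, τ * h ∈ reflexLift Φ φh ↔ τ ∈ reflexLift Φ φh) :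
    H ≤ MulAction.stabilizer G Φ :=
  fun u hu => (forall_mul_mem_reflexLift_iff Φ φh u).1 (hH u hu)

/-- Membership in `S*` depends only on the left coset `τ H*`: `τ ∈ S* ↔ ∃ τ' ∈ S*, τ'⁻¹ τ ∈ H*` — the
group-level form of "`S*` is the set of all the elements of `G` inducing on `K*` some `ψⱼ`".
[cite: Shimura1998, §8.3 proof of Prop. 28] -/
theorem mem_reflexLift_iff_exists (Φ : Set E) (φh : E) (τ : G) :
    τ ∈ reflexLift Φ φh ↔ ∃ τ' ∈ reflexLift Φ φh, τ'⁻¹ * τ ∈ MulAction.stabilizer G Φ := by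
  refine ⟨fun h => ⟨τ, h, by simp⟩, ?_⟩
  rintro ⟨τ', hτ', hs⟩
  have := (mul_mem_reflexLift_iff_of_mem_stabilizer Φ φh hs τ').2 hτ'
  simpa using this

/-! ### `H'` and the reflex of the reflex -/

/-- **`H'` is the right stabiliser of `S`**: `u ∈ Stab(S*)` (left translation) `↔ ∀ g, g u ∈ S ↔ g ∈ S`.
This identifies `MulAction.stabilizer G (reflexLift Φ φh)` with Shimura's `H' = {γ | γS = S}` (exponential
notation) and Streng's `{σ | Φ_L σ = Φ_L}`. [cite: Streng2010, Ch. I Lemma 3.5] -/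
theorem mem_stabilizer_reflexLift_iff (Φ : Set E) (φh : E) (u : G) :
    u ∈ MulAction.stabilizer G (reflexLift Φ φh : Set G) ↔
      ∀ g : G, g * u ∈ typeLift Φ φh ↔ g ∈ typeLift Φ φh := by
  rw [MulAction.mem_stabilizer_iff]
  constructor
  · intro hu g
    have h1 : g⁻¹ ∈ u • (reflexLift Φ φh : Set G) ↔ g⁻¹ ∈ (reflexLift Φ φh : Set G) := by rw [hu]
    rw [Set.mem_smul_set_iff_inv_smul_mem, smul_eq_mul, mem_reflexLift, mem_reflexLift, mul_inv_rev, inv_inv,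
      inv_inv] at h1
    rw [mem_typeLift, mem_typeLift]
    exact h1
  · intro h
    ext τ
    rw [Set.mem_smul_set_iff_inv_smul_mem, smul_eq_mul, mem_reflexLift, mem_reflexLift, mul_inv_rev, inv_inv]
    exact h τ⁻¹

/-- `H₁ ≤ H'`: `Gal(L/F)` stabilises `S*`, i.e. the field `K'` of `H'` (the reflex field of the reflex) lies in
`F` — "F contains the field K' corresponding to H'" (proof of Prop. 26); "`Kʳʳ` is a subfield of `K`"
(Streng Lemma 7.2). [cite: Shimura1998, §8.2 proof of Prop. 26] -/
theorem stabilizer_le_stabilizer_reflexLift (Φ : Set E) (φh : E) :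
    MulAction.stabilizer G φh ≤ MulAction.stabilizer G (reflexLift Φ φh : Set G) := fun u hu =>
  (mem_stabilizer_reflexLift_iff Φ φh u).2 (mul_mem_typeLift_iff_of_mem_stabilizer Φ φh hu)

/-- The construction applied to the lifted reflex type `S* ⊆ G = Hom(L, L)` (the group acting on itself by left
translation, base point `1`): `(S*)* = S`. [cite: Streng2010, Ch. I Lemma 7.2] -/
theorem reflexLift_reflexLift_one (Φ : Set E) (φh : E) :
    (reflexLift (reflexLift Φ φh : Set G) (1 : G) : Set G) = typeLift Φ φh := by
  ext g
  rw [mem_reflexLift, smul_eq_mul, mul_one, inv_mem_reflexLift_iff]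

/-- Dually, the type of `L` induced by the `L`-type `S*` (base point `1`) is `S*` itself. [folklore] -/
theorem typeLift_reflexLift_one (Φ : Set E) (φh : E) :
    (typeLift (reflexLift Φ φh : Set G) (1 : G) : Set G) = reflexLift Φ φh := by
  ext g
  rw [mem_typeLift, smul_eq_mul, mul_one]

/-- `g ∈ S · H' ↔ g ∘ φh ∈ Φ`: membership in the lift to `L` of the reflex type of the reflex type
(`S` saturated under `H'`) is membership in `S`. [cite: Streng2010, Ch. I Lemma 7.2] -/
theorem mem_typeLift_mul_stabilizer_iff (Φ : Set E) (φh : E) (g : G) :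
    g ∈ typeLift Φ φh * (MulAction.stabilizer G (reflexLift Φ φh : Set G) : Set G) ↔ g • φh ∈ Φ := by
  constructor
  · rintro ⟨a, ha, s, hs, rfl⟩
    exact ((mem_stabilizer_reflexLift_iff Φ φh s).1 hs a).2 ha
  · intro hg
    exact ⟨g, hg, 1, (MulAction.stabilizer G (reflexLift Φ φh : Set G)).one_mem, mul_one g⟩

/-- `S · H' = S`: the type `S` of `L` is induced from the fixed field `K'` of `H'` (the reflex field of the
reflex), i.e. "`Φ` is induced by `Φʳʳ`" at the level of `L`. [cite: Streng2010, Ch. I Lemma 7.2] -/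
theorem typeLift_mul_stabilizer_eq (Φ : Set E) (φh : E) :
    typeLift Φ φh * (MulAction.stabilizer G (reflexLift Φ φh : Set G) : Set G) = typeLift Φ φh := by
  ext g
  rw [mem_typeLift_mul_stabilizer_iff, mem_typeLift]

/-- **The reflex of the reflex induces `Φ`**: `{g ∘ φh | g ∈ S · H'} = Φ` for a transitive action — the reflex
type of the reflex type, induced up to `F` along `φh`, is `Φ` itself ("`Φ` is induced by `Φʳʳ`", Streng Lemma 7.2;
"if a CM-type is primitive, then it coincides with the reflex of its reflex", Shimura §8.3).
[cite: Streng2010, Ch. I Lemma 7.2] -/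
theorem image_typeLift_mul_stabilizer_eq [MulAction.IsPretransitive G E] (Φ : Set E) (φh : E) :
    (fun g : G => g • φh) '' (typeLift Φ φh * (MulAction.stabilizer G (reflexLift Φ φh : Set G) : Set G)) = Φ := by
  ext x
  constructor
  · rintro ⟨g, hg, rfl⟩
    exact (mem_typeLift_mul_stabilizer_iff Φ φh g).1 hg
  · intro hx
    obtain ⟨g, rfl⟩ := MulAction.exists_smul_eq G φh x
    exact ⟨g, (mem_typeLift_mul_stabilizer_iff Φ φh g).2 hx, rfl⟩

/-! ### Primitive types -/

variable (G) in
/-- **Primitivity, group-theoretically.**  `Φ` is induced (Streng, Def. 3.2: `Φ = {φ | φ|_{F₁} ∈ Φ₁}`) from the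
fixed field `F₁ ⊆ F` of a subgroup `H ⊇ H₁ = Gal(L/F)` exactly when `S` is right-invariant under `H`; we call
`(Φ, φh)` PRIMITIVE when this happens for no subgroup strictly above `H₁`.  For a CM type this is "not induced
from a CM type of a strict CM subfield" (Def. 3.2), which Shimura (§8.2) shows equivalent to the simplicity of the
abelian varieties of type `Φ` — the latter is not formalised here. [cite: Streng2010, Ch. I Def. 3.2] -/
def IsPrimitive (Φ : Set E) (φh : E) : Prop :=
  ∀ H : Subgroup G, MulAction.stabilizer G φh ≤ H →
    (∀ h ∈ H, ∀ g : G, g * h ∈ typeLift Φ φh ↔ g ∈ typeLift Φ φh) → H ≤ MulAction.stabilizer G φh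

/-- **Shimura's criterion** (Prop. 26: "`(F; {φᵢ})` is primitive if and only if `H₁ = H'`"; Streng (3.6):
`Gal(L/K₁) = {σ | Φ_L σ = Φ_L}`): `H'` is the largest subgroup under which `S` is right-invariant, so `(Φ, φh)` is
primitive iff `H' ≤ H₁` (the reverse inclusion always holds, `stabilizer_le_stabilizer_reflexLift`).
[cite: Shimura1998, §8.2 Prop. 26] -/
theorem isPrimitive_iff (Φ : Set E) (φh : E) :
    IsPrimitive G Φ φh ↔ MulAction.stabilizer G (reflexLift Φ φh : Set G) ≤ MulAction.stabilizer G φh := by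
  constructor
  · intro hP
    exact hP _ (stabilizer_le_stabilizer_reflexLift Φ φh) fun h hh => (mem_stabilizer_reflexLift_iff Φ φh h).1 hh
  · intro hle H _ hH u hu
    exact hle ((mem_stabilizer_reflexLift_iff Φ φh u).2 (hH u hu))

/-- For a primitive type, `H' = H₁`: the reflex field of the reflex is `F` itself ("if `Φ` is primitive, then
`Kʳʳ = K` and `Φʳʳ = Φ`", Streng Lemma 7.2). [cite: Streng2010, Ch. I Lemma 7.2] -/
theorem IsPrimitive.stabilizer_reflexLift_eq {Φ : Set E} {φh : E} (hP : IsPrimitive G Φ φh) :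
    MulAction.stabilizer G (reflexLift Φ φh : Set G) = MulAction.stabilizer G φh :=
  le_antisymm ((isPrimitive_iff Φ φh).1 hP) (stabilizer_le_stabilizer_reflexLift Φ φh)

/-- For a primitive type the lift of the reflex-of-reflex type is read directly on `S`: `g ∈ S ↔ g ∘ φh ∈ Φ`, and
an element of `G` stabilising `S*` fixes `φh` (hence `F` pointwise). [cite: Streng2010, Ch. I Lemma 7.2] -/
theorem IsPrimitive.smul_eq_of_mem_stabilizer_reflexLift {Φ : Set E} {φh : E} (hP : IsPrimitive G Φ φh) {u : G}
    (hu : u ∈ MulAction.stabilizer G (reflexLift Φ φh : Set G)) : u • φh = φh := by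
  rw [hP.stabilizer_reflexLift_eq, MulAction.mem_stabilizer_iff] at hu
  exact hu

/-! ### The reflex field -/

section Field

variable (F Ω : Type*) [Field F] [Field Ω] [Algebra F Ω] {E' : Type*} [MulAction (Ω ≃ₐ[F] Ω) E']

/-- The **reflex field** `K*` of the type `Φ` over a Galois extension `Ω/F` (in print `L/ℚ` or `ℚ̄/ℚ`) whose
Galois group acts on `E' = Hom(K, Ω)`: the fixed field of `H* = {γ | γ • Φ = Φ}` ("Let `K*` be the subfield of
`L` corresponding to `H*`"; Streng §4: "the reflex field `Kʳ` of `(K, Φ)` is the fixed field of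
`{τ | τΦ = Φ}`"). [cite: Shimura1998, §8.3 Prop. 28] -/
def reflexField (Φ : Set E') : IntermediateField F Ω :=
  IntermediateField.fixedField (MulAction.stabilizer (Ω ≃ₐ[F] Ω) Φ)

/-- [folklore] -/
theorem reflexField_eq_fixedField (Φ : Set E') :
    reflexField F Ω Φ = IntermediateField.fixedField (MulAction.stabilizer (Ω ≃ₐ[F] Ω) Φ) := rfl

/-- `H* ≤ Gal(Ω/K*)`. [folklore] -/
theorem stabilizer_le_fixingSubgroup_reflexField (Φ : Set E') :
    MulAction.stabilizer (Ω ≃ₐ[F] Ω) Φ ≤ (reflexField F Ω Φ).fixingSubgroup :=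
  (IntermediateField.le_iff_le _ _).1 le_rfl

/-- If `H ≤ H*` then `K* ⊆ Ω^H`. [folklore] -/
theorem reflexField_le_fixedField {Φ : Set E'} {H : Subgroup (Ω ≃ₐ[F] Ω)}
    (hH : H ≤ MulAction.stabilizer (Ω ≃ₐ[F] Ω) Φ) : reflexField F Ω Φ ≤ IntermediateField.fixedField H :=
  IntermediateField.fixedField_le hH

/-- **The reflex field is the field of definition of `S*`.**  Over a Galois extension `Ω/F` with `Gal(Ω/F)`
acting transitively on `E'`: if `S*` is right-invariant under `Gal(Ω/T)` for an intermediate field `T` (the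
indicator of `S*` factors through restriction to `T`), then `K* ≤ T`. [folklore] -/
theorem reflexField_le_of_forall_mul_mem_iff [IsGalois F Ω] [MulAction.IsPretransitive (Ω ≃ₐ[F] Ω) E']
    (Φ : Set E') (φh : E') (T : IntermediateField F Ω)
    (hT : ∀ h ∈ T.fixingSubgroup, ∀ τ : Ω ≃ₐ[F] Ω, τ * h ∈ reflexLift Φ φh ↔ τ ∈ reflexLift Φ φh) :
    reflexField F Ω Φ ≤ T := by
  have hle : T.fixingSubgroup ≤ MulAction.stabilizer (Ω ≃ₐ[F] Ω) Φ :=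
    le_stabilizer_of_forall_mul_mem_reflexLift_iff Φ φh _ hT
  calc reflexField F Ω Φ
      ≤ IntermediateField.fixedField T.fixingSubgroup := IntermediateField.fixedField_le hle
    _ = T := InfiniteGalois.fixedField_fixingSubgroup T

/-- The reflex field of the reflex lies in the fixed field of `H₁` (which is `F·` when `E' = Hom(K, Ω)` and
`φh` the inclusion: "`Kʳʳ ⊆ K`"). [cite: Streng2010, Ch. I Lemma 7.2] -/
theorem fixedField_stabilizer_reflexLift_le (Φ : Set E') (φh : E') :
    IntermediateField.fixedField (MulAction.stabilizer (Ω ≃ₐ[F] Ω) (reflexLift Φ φh : Set (Ω ≃ₐ[F] Ω))) ≤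
      IntermediateField.fixedField (MulAction.stabilizer (Ω ≃ₐ[F] Ω) φh) :=
  IntermediateField.fixedField_le (stabilizer_le_stabilizer_reflexLift Φ φh)

end Field

end Literature.NumberTheory.ComplexMultiplication
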